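/-
Copyright: statement-level skeleton of a published paper (lit-balaban cell, Phase-2 proof seat p13, gen 6). No proof
claims beyond what the kernel checks below.
-/
import Literature.MathematicalPhysics.QuantumFieldTheory.BalabanImbrieJaffe1984to88.BIJ88IntegrationByParts305
import Literature.MathematicalPhysics.QuantumFieldTheory.BalabanImbrieJaffe1984to88.BIJ88DirichletDeriv305

/-!
# `BalabanImbrieJaffe1984to88.BIJ88SDerivative305` — T. Bałaban, J. Imbrie, A. Jaffe, *Effective action and cluster
properties of the abelian Higgs model*, Commun. Math. Phys. **114** (1988) 257–315 [BalabanImbrieJaffe1988], §5.13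
p. 305 [PDF 49]: **"To calculate the s-derivatives, note that the first derivative produces a term
⟨Σ_{j≠i} s_j⟨□_iΦ, Δ□_jΦ⟩; Π_{i∈I} f(□_i)⟩_{s_Γ}. Subsequent derivatives either hit factors s_j already pulled down or
bring new terms down with new truncations."** — PROVED AT THE LEVEL OF THE GAUSSIAN INTEGRAL AND OF THE NORMALIZED
EXPECTATION: differentiation under the integral sign of `∫ G(Φ) e^{−½⟨Φ,Δ_sΦ⟩}e^{⟨ℱ,Φ⟩}dΦ` in one interpolation
parameter `s_i`, and the quotient rule giving the truncated expectation `⟨D_i; G⟩_s = ⟨D_iG⟩_s − ⟨D_i⟩_s⟨G⟩_s`,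
`D_i(Φ) = Σ_{j≠i} s_j⟨□_iΦ, Δ□_jΦ⟩`.

statement-level skeleton of published theorems with citation tags; proofs where landed; nothing here is a claim
about the Yang–Mills mass gap

PDF held: `paper:balaban1988-cmp114-bij-abelian-higgs-effective-action` (journal page = PDF page + 256; p. 305 read with
`lit read … --pages 49`).

CITATION HEADER (lean-in-tree rule).  lit-balaban cell (HOME `run/shared/lean/pub/lit-balaban/`), Phase 2, seat p13
gen 6 (unit `lit-balaban-p13-g6`); fifth file of the p. 305–306 group (`…BIJ88CsDecay305` p254974, `…BIJ88CsClusters306`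
p255115, `…BIJ88ClusterFactorization306` p255752, `…BIJ88IntegrationByParts305` p256140); row **C2.Eq5.13.3-5.13.4** of
`HOME/lit-balaban-r16/ROWS-C2-part2.md` (owner r16, referee ref-5), the p. 305 member quoted above.  The FORM-LEVEL
derivative is p02's `…BIJ88DirichletDeriv305` (p253961): `blockPair blk Δ Φ i j = ⟨□_iΦ, Δ□_jΦ⟩`,
`quadForm_interpForm_update` (`⟨Φ,Δ_{s[i↦t]}Φ⟩` is affine in `t`), `hasDerivAt_quadForm_interpForm`, `blockPair_comm` — USED
BY NAME, nothing restated; its docstring says verbatim *"that differentiating the Gaussian EXPECTATION ⟨·⟩_s produces the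
truncated expectation ⟨A; B⟩ of this term is the standard Gaussian calculus and is not modelled here"* — this file
models it.  Also used: `…BIJ88DirichletForms305` (`interpForm`, `interpForm_posDef`, `quadForm_interpForm_ge/le` —
*"To preserve positivity and boundedness properties"*), `…BIJ88IntegrationByParts305` (moments of the tilted Gaussian
`integrable_fieldProd_tilt`, `integrable_bdd_mul_weight_source`, `source_eq`, `isSymm_of_posDef`), the weight
`weight A Φ = e^{−½⟨Φ,AΦ⟩}` / linear term `source ℱ Φ` of `…Balaban1983to89.B2Eq228Conditioning`
(`integrable_weight_mul_source`), and Mathlib's dominated differentiation under the integral sign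
`hasDerivAt_integral_of_dominated_loc_of_deriv_le`.

## What is proved (0 `sorry`, standard axioms, theorems only, no new `def`)

Setting of `BIJ88DirichletForms305`/`BIJ88DirichletDeriv305`: sites `α`, regions `blk : α → I`, a real matrix `Δ`
(feed `Δ := −Δ_print`, positive definite, with the (5.6)-type form bounds `c‖v‖² ≤ ⟨v,Δv⟩ ≤ C‖v‖²` of [6]),
parameters `s ∈ [0,1]^I`, the interpolated precision `Δ_s = interpForm blk Δ s`, and the Gaussian integral
`∫ G(Φ) e^{−½⟨Φ,Δ_sΦ⟩}e^{⟨ℱ,Φ⟩}dΦ` with a bounded measurable observable `G` (the `Π f(□_i)` and cutoffs).  Write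
`D_i(Φ) := Σ_{j≠i} s_j ⟨□_iΦ, Δ□_jΦ⟩` (inline, no new `def`).
* §1 `hasDerivAt_weight_interp`: `∂/∂s_i e^{−½⟨Φ,Δ_sΦ⟩} = −D_i(Φ) e^{−½⟨Φ,Δ_sΦ⟩}` (chain rule on p02's form derivative).
* §2 `update_mem_cube`, `abs_slope_le`, **`quadForm_interp_ge_near`**: for `s_i = t` within `c/(2|C−c|+c)` of a
  `t₀ ∈ [0,1]` the form keeps the uniform lower bound `(c/2)‖Φ‖² ≤ ⟨Φ,Δ_{s[i↦t]}Φ⟩` (affinity in `s_i` + the inherited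
  bounds at `s_i = 0, 1, t₀`), and `|D_i(Φ)| ≤ (|C−c|/2)‖Φ‖²` (`abs_D_le`).
* §3 **`hasDerivAt_integral_interp`** — THE FIRST DERIVATIVE AT THE LEVEL OF THE INTEGRAL: for `t₀ ∈ [0,1]`,
  `d/dt|_{t₀} ∫ G e^{−½⟨Φ,Δ_{s[i↦t]}Φ⟩}e^{⟨ℱ,Φ⟩}dΦ = −∫ D_i·G·e^{−½⟨Φ,Δ_{s[i↦t₀]}Φ⟩}e^{⟨ℱ,Φ⟩}dΦ`, the derivative integrand
  being integrable (dominated convergence; dominating function `K₀(|C−c|/2)‖Φ‖²e^{⟨ℱ,Φ⟩}e^{−(c/4)‖Φ‖²}`, integrable by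
  the moment lemmas of `BIJ88IntegrationByParts305`).
* §4 `integral_weight_mul_source_pos` (the partition function is `> 0`) and **`hasDerivAt_expectation_interp`** — THE
  PRINTED STATEMENT: for the normalized expectation `⟨G⟩_t = ∫G dμ_t / ∫dμ_t`,
  `d/dt|_{t₀} ⟨G⟩_t = −(⟨D_iG⟩_{t₀} − ⟨D_i⟩_{t₀}⟨G⟩_{t₀}) = −⟨D_i; G⟩_{t₀}`, the truncated expectation.  With the printed
  sign convention (`Δ_print = −Δ`, weight `e^{½⟨Φ,Δ_{print,s}Φ⟩}`) `−D_i = Σ_{j≠i}s_j⟨□_iΦ, Δ_print□_jΦ⟩`, i.e. exactly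
  *"the first derivative produces a term ⟨Σ_{j≠i} s_j⟨□_iΦ, Δ□_jΦ⟩; Π f(□_i)⟩_{s_Γ}"*.
* §5 `hasDerivAt_pulledFactor`: *"Subsequent derivatives either hit factors s_j already pulled down …"* — the pulled-down
  factor `D_i` is affine in each other parameter, `∂D_i/∂s_{i′} = ⟨□_iΦ, Δ□_{i′}Φ⟩` (`i′ ≠ i`).
HONEST SCOPE.  One parameter at a time (the mixed derivative `∂/∂s_Γ` is the iterate, not spelled out); bounded
measurable `G` (characteristic functions allowed here — no derivative of `G` is taken); real fields, finite dimension;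
the resummation into (5.13.3) and "new truncations" beyond the first are NOT modelled.  NOT summit progress; NOT
continuum; NOT Clay.  Imports: `BIJ88IntegrationByParts305`, `BIJ88DirichletDeriv305`; modifies nothing.
-/

namespace Literature.MathematicalPhysics.QuantumFieldTheory.BalabanImbrieJaffe1984to88.BIJ88SDerivative305

open MeasureTheory Matrix Finset Filter Function Metric
open scoped BigOperators Topology
open Literature.MathematicalPhysics.QuantumFieldTheory.Balaban1983to89
open B2Eq228Conditioning (weight source)
open BIJ88DirichletForms305 (interpForm interpForm_posDef quadForm_interpForm_ge quadForm_interpForm_le boxProj)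
open BIJ88DirichletDeriv305 (blockPair blockPair_comm quadForm_interpForm_update hasDerivAt_quadForm_interpForm)
open BIJ88IntegrationByParts305 (source_eq weight_mul_source integrable_tilt integrable_fieldProd_tilt
  integrable_bdd_mul_weight_source continuous_dotProduct_right continuous_gauss isSymm_of_posDef)

variable {α I : Type} [Fintype α] [DecidableEq α] [Fintype I] [DecidableEq I] (blk : α → I)

/-! ## §1  The `s_i`-derivative of the Gaussian weight -/

/-- For symmetric `Δ`, `Σ_{j≠i} s_j(⟨□_iΦ,Δ□_jΦ⟩ + ⟨□_jΦ,Δ□_iΦ⟩) = 2·D_i(Φ)`, `D_i(Φ) = Σ_{j≠i} s_j⟨□_iΦ,Δ□_jΦ⟩` — the slope of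
`⟨Φ,Δ_sΦ⟩` in `s_i` is twice the printed term. [cite: BalabanImbrieJaffe1988, §5.13 p.305] -/
theorem slope_eq_two_mul_D {Δ : Matrix α α ℝ} (hΔ : Δ.IsSymm) (s : I → ℝ) (i : I) (φ : α → ℝ) :
    ∑ j ∈ univ.erase i, s j * (blockPair blk Δ φ i j + blockPair blk Δ φ j i)
      = 2 * ∑ j ∈ univ.erase i, s j * blockPair blk Δ φ i j := by
  rw [Finset.mul_sum]
  refine Finset.sum_congr rfl fun j _ => ?_
  rw [blockPair_comm blk hΔ]
  ring

/-- **`∂/∂s_i e^{−½⟨Φ,Δ_sΦ⟩} = −D_i(Φ)·e^{−½⟨Φ,Δ_sΦ⟩}`** (`Δ` symmetric), `D_i(Φ) = Σ_{j≠i} s_j⟨□_iΦ,Δ□_jΦ⟩`: the factor the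
first `s`-derivative pulls down from the Gaussian weight (chain rule on `BIJ88DirichletDeriv305.hasDerivAt_quadForm_interpForm`).
[cite: BalabanImbrieJaffe1988, §5.13 p.305] -/
theorem hasDerivAt_weight_interp {Δ : Matrix α α ℝ} (hΔ : Δ.IsSymm) (s : I → ℝ) (i : I) (φ : α → ℝ) (t : ℝ) :
    HasDerivAt (fun u => weight (interpForm blk Δ (update s i u)) φ)
      (-(∑ j ∈ univ.erase i, s j * blockPair blk Δ φ i j) * weight (interpForm blk Δ (update s i t)) φ) t := by
  have h := ((hasDerivAt_quadForm_interpForm blk Δ s i φ t).const_mul (-(1/2 : ℝ))).exp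
  refine h.congr_deriv ?_
  rw [slope_eq_two_mul_D blk hΔ, B2Eq228Conditioning.weight]
  ring

/-! ## §2  Uniform form bounds near a parameter value `t₀ ∈ [0,1]` -/

omit [Fintype I] in
/-- Updating one coordinate of `s ∈ [0,1]^I` by `u ∈ [0,1]` stays in the cube. [cite: BalabanImbrieJaffe1988, §5.13 p.305] -/
theorem update_mem_cube {s : I → ℝ} (hs : ∀ j, 0 ≤ s j ∧ s j ≤ 1) (i : I) {u : ℝ} (hu : 0 ≤ u ∧ u ≤ 1) (j : I) :
    0 ≤ update s i u j ∧ update s i u j ≤ 1 := by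
  rcases eq_or_ne j i with rfl | hj
  · rw [update_self]
    exact hu
  · rw [update_of_ne hj]
    exact hs j

/-- **The slope is controlled by the form bounds**: if `c‖v‖² ≤ ⟨v,Δv⟩ ≤ C‖v‖²` and `s ∈ [0,1]^I`, then
`|Σ_{j≠i} s_j(⟨□_iΦ,Δ□_jΦ⟩ + ⟨□_jΦ,Δ□_iΦ⟩)| ≤ |C − c|·‖Φ‖²` (the slope is `⟨Φ,Δ_{s[i↦1]}Φ⟩ − ⟨Φ,Δ_{s[i↦0]}Φ⟩`, both
forms inheriting the bounds — *"To preserve positivity and boundedness properties"*). [cite: BalabanImbrieJaffe1988, §5.13 p.305] -/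
theorem abs_slope_le {Δ : Matrix α α ℝ} {c C : ℝ} (hcΔ : ∀ v, c * (v ⬝ᵥ v) ≤ v ⬝ᵥ (Δ *ᵥ v))
    (hCΔ : ∀ v, v ⬝ᵥ (Δ *ᵥ v) ≤ C * (v ⬝ᵥ v)) {s : I → ℝ} (hs : ∀ j, 0 ≤ s j ∧ s j ≤ 1) (i : I) (φ : α → ℝ) :
    |∑ j ∈ univ.erase i, s j * (blockPair blk Δ φ i j + blockPair blk Δ φ j i)| ≤ |C - c| * (φ ⬝ᵥ φ) := by
  have hn : 0 ≤ φ ⬝ᵥ φ := Finset.sum_nonneg fun x _ => mul_self_nonneg (φ x)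
  have h1 := quadForm_interpForm_update blk Δ s i φ 1
  rw [one_mul] at h1
  have h0l := quadForm_interpForm_ge blk hcΔ (update_mem_cube hs i ⟨le_refl (0:ℝ), zero_le_one⟩) φ
  have h0u := quadForm_interpForm_le blk hCΔ (update_mem_cube hs i ⟨le_refl (0:ℝ), zero_le_one⟩) φ
  have h1l := quadForm_interpForm_ge blk hcΔ (update_mem_cube hs i ⟨zero_le_one, le_refl (1:ℝ)⟩) φ
  have h1u := quadForm_interpForm_le blk hCΔ (update_mem_cube hs i ⟨zero_le_one, le_refl (1:ℝ)⟩) φ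
  have hK : (C - c) * (φ ⬝ᵥ φ) ≤ |C - c| * (φ ⬝ᵥ φ) := mul_le_mul_of_nonneg_right (le_abs_self _) hn
  rw [abs_le]
  constructor <;> linarith

/-- `|D_i(Φ)| ≤ (|C − c|/2)‖Φ‖²` for symmetric `Δ` with the form bounds. [cite: BalabanImbrieJaffe1988, §5.13 p.305] -/
theorem abs_D_le {Δ : Matrix α α ℝ} (hΔ : Δ.IsSymm) {c C : ℝ} (hcΔ : ∀ v, c * (v ⬝ᵥ v) ≤ v ⬝ᵥ (Δ *ᵥ v))
    (hCΔ : ∀ v, v ⬝ᵥ (Δ *ᵥ v) ≤ C * (v ⬝ᵥ v)) {s : I → ℝ} (hs : ∀ j, 0 ≤ s j ∧ s j ≤ 1) (i : I) (φ : α → ℝ) :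
    |∑ j ∈ univ.erase i, s j * blockPair blk Δ φ i j| ≤ |C - c| / 2 * (φ ⬝ᵥ φ) := by
  have h := abs_slope_le blk hcΔ hCΔ hs i φ
  rw [slope_eq_two_mul_D blk hΔ, abs_mul, abs_of_pos (two_pos : (0:ℝ) < 2)] at h
  linarith

/-- **Uniform positivity near `t₀`**: with `c‖v‖² ≤ ⟨v,Δv⟩ ≤ C‖v‖²` (`c > 0`), `s ∈ [0,1]^I`, `t₀ ∈ [0,1]` and
`|t − t₀| ≤ c/(2|C−c| + c)`:  `(c/2)‖Φ‖² ≤ ⟨Φ, Δ_{s[i↦t]}Φ⟩` — also slightly OUTSIDE the cube, as needed to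
differentiate at the endpoints `s_i = 0, 1`. [cite: BalabanImbrieJaffe1988, §5.13 p.305] -/
theorem quadForm_interp_ge_near {Δ : Matrix α α ℝ} {c C : ℝ} (hc : 0 < c)
    (hcΔ : ∀ v, c * (v ⬝ᵥ v) ≤ v ⬝ᵥ (Δ *ᵥ v)) (hCΔ : ∀ v, v ⬝ᵥ (Δ *ᵥ v) ≤ C * (v ⬝ᵥ v))
    {s : I → ℝ} (hs : ∀ j, 0 ≤ s j ∧ s j ≤ 1) (i : I) {t₀ : ℝ} (ht₀ : 0 ≤ t₀ ∧ t₀ ≤ 1) {t : ℝ}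
    (ht : |t - t₀| ≤ c / (2 * |C - c| + c)) (φ : α → ℝ) :
    c / 2 * (φ ⬝ᵥ φ) ≤ φ ⬝ᵥ (interpForm blk Δ (update s i t) *ᵥ φ) := by
  have hn : 0 ≤ φ ⬝ᵥ φ := Finset.sum_nonneg fun x _ => mul_self_nonneg (φ x)
  have hK : 0 ≤ |C - c| := abs_nonneg _
  have hQt : φ ⬝ᵥ (interpForm blk Δ (update s i t) *ᵥ φ)
      = φ ⬝ᵥ (interpForm blk Δ (update s i t₀) *ᵥ φ)
        + (t - t₀) * ∑ j ∈ univ.erase i, s j * (blockPair blk Δ φ i j + blockPair blk Δ φ j i) := by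
    rw [quadForm_interpForm_update blk Δ s i φ t, quadForm_interpForm_update blk Δ s i φ t₀]
    ring
  have h1 : c * (φ ⬝ᵥ φ) ≤ φ ⬝ᵥ (interpForm blk Δ (update s i t₀) *ᵥ φ) :=
    quadForm_interpForm_ge blk hcΔ (update_mem_cube hs i ht₀) φ
  have hE := abs_slope_le blk hcΔ hCΔ hs i φ
  have hεK : c / (2 * |C - c| + c) * (|C - c| * (φ ⬝ᵥ φ)) ≤ c / 2 * (φ ⬝ᵥ φ) := by
    rw [div_mul_eq_mul_div, div_le_iff₀ (by positivity)]
    nlinarith [mul_nonneg (mul_nonneg hc.le hc.le) hn, mul_nonneg hK hn]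
  have h2 : |(t - t₀) * ∑ j ∈ univ.erase i, s j * (blockPair blk Δ φ i j + blockPair blk Δ φ j i)|
      ≤ c / 2 * (φ ⬝ᵥ φ) := by
    rw [abs_mul]
    exact (mul_le_mul ht hE (abs_nonneg _) (by positivity)).trans hεK
  have h3 := neg_abs_le ((t - t₀) * ∑ j ∈ univ.erase i, s j * (blockPair blk Δ φ i j + blockPair blk Δ φ j i))
  rw [hQt]
  linarith

/-! ## §3  The first `s`-derivative at the level of the Gaussian integral -/

/-- **"the first derivative produces a term Σ_{j≠i} s_j⟨□_iΦ, Δ□_jΦ⟩"** — AT THE LEVEL OF THE INTEGRAL (dominated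
differentiation under the integral sign).  `Δ` positive definite with form bounds `c‖v‖² ≤ ⟨v,Δv⟩ ≤ C‖v‖²` (`c > 0`),
`s ∈ [0,1]^I`, `t₀ ∈ [0,1]`, `G` bounded measurable.  Then the derivative integrand is integrable and
`d/dt|_{t₀} ∫ G(Φ) e^{−½⟨Φ,Δ_{s[i↦t]}Φ⟩}e^{⟨ℱ,Φ⟩}dΦ = −∫ D_i(Φ) G(Φ) e^{−½⟨Φ,Δ_{s[i↦t₀]}Φ⟩}e^{⟨ℱ,Φ⟩}dΦ`,
`D_i(Φ) = Σ_{j≠i} s_j⟨□_iΦ,Δ□_jΦ⟩`. [cite: BalabanImbrieJaffe1988, §5.13 p.305] -/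
theorem hasDerivAt_integral_interp {Δ : Matrix α α ℝ} (hΔ : Δ.PosDef) {c C : ℝ} (hc : 0 < c)
    (hcΔ : ∀ v, c * (v ⬝ᵥ v) ≤ v ⬝ᵥ (Δ *ᵥ v)) (hCΔ : ∀ v, v ⬝ᵥ (Δ *ᵥ v) ≤ C * (v ⬝ᵥ v))
    {s : I → ℝ} (hs : ∀ j, 0 ≤ s j ∧ s j ≤ 1) (i : I) {t₀ : ℝ} (ht₀ : 0 ≤ t₀ ∧ t₀ ≤ 1) (f : α → ℝ)
    {G : (α → ℝ) → ℝ} (hGm : AEStronglyMeasurable G volume) {K₀ : ℝ} (hK : ∀ φ, ‖G φ‖ ≤ K₀) :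
    Integrable (fun φ : α → ℝ => (∑ j ∈ univ.erase i, s j * blockPair blk Δ φ i j) * G φ *
        (weight (interpForm blk Δ (update s i t₀)) φ * source f φ)) ∧
    HasDerivAt (fun u => ∫ φ : α → ℝ, G φ * (weight (interpForm blk Δ (update s i u)) φ * source f φ))
      (-(∫ φ : α → ℝ, (∑ j ∈ univ.erase i, s j * blockPair blk Δ φ i j) * G φ *
        (weight (interpForm blk Δ (update s i t₀)) φ * source f φ))) t₀ := by
  have hΔs : Δ.IsSymm := isSymm_of_posDef hΔ
  have hε : 0 < c / (2 * |C - c| + c) := by positivity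
  have hK0 : 0 ≤ K₀ := (norm_nonneg _).trans (hK 0)
  -- continuity (for measurability)
  have hwc : ∀ u : ℝ, Continuous fun φ : α → ℝ => weight (interpForm blk Δ (update s i u)) φ := fun u =>
    continuous_gauss _
  have hsc : Continuous fun φ : α → ℝ => source f φ :=
    (continuous_dotProduct_right f).rexp.congr fun φ => (source_eq f φ).symm
  have hDc : Continuous fun φ : α → ℝ => ∑ j ∈ univ.erase i, s j * blockPair blk Δ φ i j := by
    refine continuous_finsetSum _ fun j _ => continuous_const.mul ?_
    show Continuous fun φ : α → ℝ => (boxProj blk i *ᵥ φ) ⬝ᵥ (Δ *ᵥ (boxProj blk j *ᵥ φ))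
    exact (continuous_const.matrix_mulVec continuous_id).dotProduct
      (continuous_const.matrix_mulVec (continuous_const.matrix_mulVec continuous_id))
  -- the hypotheses of dominated differentiation
  have hF_meas : ∀ᶠ u in 𝓝 t₀, AEStronglyMeasurable
      (fun φ : α → ℝ => G φ * (weight (interpForm blk Δ (update s i u)) φ * source f φ)) volume :=
    Eventually.of_forall fun u => hGm.mul ((hwc u).mul hsc).aestronglyMeasurable
  have hF_int : Integrable (fun φ : α → ℝ => G φ * (weight (interpForm blk Δ (update s i t₀)) φ * source f φ)) :=
    integrable_bdd_mul_weight_source (interpForm_posDef blk hΔ (update_mem_cube hs i ht₀)) f hGm hK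
  have hF'_meas : AEStronglyMeasurable (fun φ : α → ℝ => G φ *
      ((-(∑ j ∈ univ.erase i, s j * blockPair blk Δ φ i j) * weight (interpForm blk Δ (update s i t₀)) φ) *
        source f φ)) volume :=
    hGm.mul (((hDc.neg.mul (hwc t₀)).mul hsc).aestronglyMeasurable)
  have h_diff : ∀ᵐ φ ∂(volume : Measure (α → ℝ)), ∀ u ∈ ball t₀ (c / (2 * |C - c| + c)),
      HasDerivAt (fun u => G φ * (weight (interpForm blk Δ (update s i u)) φ * source f φ))
        (G φ * ((-(∑ j ∈ univ.erase i, s j * blockPair blk Δ φ i j) *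
          weight (interpForm blk Δ (update s i u)) φ) * source f φ)) u :=
    Eventually.of_forall fun φ u _ => ((hasDerivAt_weight_interp blk hΔs s i φ u).mul_const _).const_mul _
  -- the dominating function: `K₀ (|C−c|/2) ‖Φ‖² e^{⟨ℱ,Φ⟩} e^{−½⟨Φ,(c/2)Φ⟩}`
  have hA' : ((c / 2) • (1 : Matrix α α ℝ)).PosDef := Matrix.PosDef.one.smul (by positivity)
  have hsq : Integrable fun φ : α → ℝ => (φ ⬝ᵥ φ) *
      (Real.exp (φ ⬝ᵥ f) * Real.exp (-(1/2 : ℝ) * (φ ⬝ᵥ ((c / 2) • (1 : Matrix α α ℝ)) *ᵥ φ))) := by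
    have h := integrable_finsetSum (Finset.univ : Finset α) fun x _ =>
      integrable_fieldProd_tilt hA' (Finset.univ : Finset (Fin 2)) (fun _ => Pi.single x (1:ℝ)) f
    refine h.congr (Eventually.of_forall fun φ => ?_)
    simp only [Fin.prod_univ_two, dotProduct_single_one]
    rw [← Finset.sum_mul]
    simp only [dotProduct]
  have bound_integrable : Integrable fun φ : α → ℝ => K₀ * (|C - c| / 2) * ((φ ⬝ᵥ φ) *
      (Real.exp (φ ⬝ᵥ f) * Real.exp (-(1/2 : ℝ) * (φ ⬝ᵥ ((c / 2) • (1 : Matrix α α ℝ)) *ᵥ φ)))) :=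
    hsq.const_mul _
  have h_bound : ∀ᵐ φ ∂(volume : Measure (α → ℝ)), ∀ u ∈ ball t₀ (c / (2 * |C - c| + c)),
      ‖G φ * ((-(∑ j ∈ univ.erase i, s j * blockPair blk Δ φ i j) *
          weight (interpForm blk Δ (update s i u)) φ) * source f φ)‖
        ≤ K₀ * (|C - c| / 2) * ((φ ⬝ᵥ φ) *
          (Real.exp (φ ⬝ᵥ f) * Real.exp (-(1/2 : ℝ) * (φ ⬝ᵥ ((c / 2) • (1 : Matrix α α ℝ)) *ᵥ φ)))) := by
    refine Eventually.of_forall fun φ u hu => ?_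
    have hu' : |u - t₀| ≤ c / (2 * |C - c| + c) := by
      rw [mem_ball, Real.dist_eq] at hu
      exact hu.le
    have hn : 0 ≤ φ ⬝ᵥ φ := Finset.sum_nonneg fun x _ => mul_self_nonneg (φ x)
    have hQ := quadForm_interp_ge_near blk hc hcΔ hCΔ hs i ht₀ hu' φ
    have hD := abs_D_le blk hΔs hcΔ hCΔ hs i φ
    have hw : weight (interpForm blk Δ (update s i u)) φ
        ≤ Real.exp (-(1/2 : ℝ) * (φ ⬝ᵥ ((c / 2) • (1 : Matrix α α ℝ)) *ᵥ φ)) := by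
      rw [B2Eq228Conditioning.weight, Real.exp_le_exp, Matrix.smul_mulVec, Matrix.one_mulVec, dotProduct_smul,
        smul_eq_mul]
      linarith
    have hw0 : 0 ≤ weight (interpForm blk Δ (update s i u)) φ := (B2Eq228Conditioning.weight_pos _ φ).le
    simp only [source_eq f, norm_mul, norm_neg, Real.norm_eq_abs, abs_of_nonneg hw0, Real.abs_exp]
    have hGφ : |G φ| ≤ K₀ := by simpa only [Real.norm_eq_abs] using hK φ
    calc |G φ| * (|∑ j ∈ univ.erase i, s j * blockPair blk Δ φ i j| *
            weight (interpForm blk Δ (update s i u)) φ * Real.exp (φ ⬝ᵥ f))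
        ≤ K₀ * ((|C - c| / 2 * (φ ⬝ᵥ φ)) *
            Real.exp (-(1/2 : ℝ) * (φ ⬝ᵥ ((c / 2) • (1 : Matrix α α ℝ)) *ᵥ φ)) * Real.exp (φ ⬝ᵥ f)) :=
          mul_le_mul hGφ (mul_le_mul_of_nonneg_right (mul_le_mul hD hw hw0 (mul_nonneg (by positivity) hn))
            (Real.exp_pos _).le) (mul_nonneg (mul_nonneg (abs_nonneg _) hw0) (Real.exp_pos _).le) hK0
      _ = _ := by ring
  have key := hasDerivAt_integral_of_dominated_loc_of_deriv_le (ball_mem_nhds t₀ hε) hF_meas hF_int hF'_meas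
    h_bound bound_integrable h_diff
  refine ⟨(key.1.neg).congr (Eventually.of_forall fun φ => ?_), key.2.congr_deriv ?_⟩
  · simp only [Pi.neg_apply]
    ring
  · rw [← integral_neg]
    congr 1
    funext φ
    ring

/-! ## §4  The normalized expectation: the truncated term -/

/-- The partition function `∫ e^{−½⟨Φ,AΦ⟩}e^{⟨ℱ,Φ⟩}dΦ` is positive (`A` positive definite).
[cite: BalabanImbrieJaffe1988, §5.13 p.305] -/
theorem integral_weight_mul_source_pos {S : Type} [Fintype S] [DecidableEq S] {A : Matrix S S ℝ} (hA : A.PosDef)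
    (f : S → ℝ) : 0 < ∫ φ : S → ℝ, weight A φ * source f φ := by
  have h : ∀ φ : S → ℝ, weight A φ * source f φ
      = Real.exp (-(1/2 : ℝ) * (φ ⬝ᵥ A *ᵥ φ) + ∑ x, f x * φ x) := fun φ => by
    rw [B2Eq228Conditioning.weight, B2Eq228Conditioning.source, Real.exp_add]
  have hint := B2Eq228Conditioning.integrable_weight_mul_source A f hA
  simp_rw [h] at hint ⊢
  exact integral_exp_pos hint

/-- **p. 305, THE PRINTED STATEMENT — "the first derivative produces a term ⟨Σ_{j≠i} s_j⟨□_iΦ, Δ□_jΦ⟩; Π_{i∈I} f(□_i)⟩_{s_Γ}"**: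
for the normalized Gaussian expectation `⟨G⟩_t := ∫ G dμ_t / ∫ dμ_t`, `dμ_t = e^{−½⟨Φ,Δ_{s[i↦t]}Φ⟩}e^{⟨ℱ,Φ⟩}dΦ`
(`Δ` positive definite with form bounds, `s ∈ [0,1]^I`, `t₀ ∈ [0,1]`, `G` bounded measurable),
`d/dt|_{t₀} ⟨G⟩_t = −(⟨D_iG⟩_{t₀} − ⟨D_i⟩_{t₀}⟨G⟩_{t₀}) = −⟨D_i; G⟩_{t₀}`, the TRUNCATED expectation of
`D_i(Φ) = Σ_{j≠i} s_j⟨□_iΦ,Δ□_jΦ⟩` against `G` (printed sign: `Δ_print = −Δ`, so `−D_i = Σ_{j≠i}s_j⟨□_iΦ, Δ_print□_jΦ⟩`).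
[cite: BalabanImbrieJaffe1988, §5.13 p.305] -/
theorem hasDerivAt_expectation_interp {Δ : Matrix α α ℝ} (hΔ : Δ.PosDef) {c C : ℝ} (hc : 0 < c)
    (hcΔ : ∀ v, c * (v ⬝ᵥ v) ≤ v ⬝ᵥ (Δ *ᵥ v)) (hCΔ : ∀ v, v ⬝ᵥ (Δ *ᵥ v) ≤ C * (v ⬝ᵥ v))
    {s : I → ℝ} (hs : ∀ j, 0 ≤ s j ∧ s j ≤ 1) (i : I) {t₀ : ℝ} (ht₀ : 0 ≤ t₀ ∧ t₀ ≤ 1) (f : α → ℝ)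
    {G : (α → ℝ) → ℝ} (hGm : AEStronglyMeasurable G volume) {K₀ : ℝ} (hK : ∀ φ, ‖G φ‖ ≤ K₀) :
    HasDerivAt
      (fun u => (∫ φ : α → ℝ, G φ * (weight (interpForm blk Δ (update s i u)) φ * source f φ))
        / ∫ φ : α → ℝ, weight (interpForm blk Δ (update s i u)) φ * source f φ)
      (-((∫ φ : α → ℝ, (∑ j ∈ univ.erase i, s j * blockPair blk Δ φ i j) * G φ *
            (weight (interpForm blk Δ (update s i t₀)) φ * source f φ))
          / (∫ φ : α → ℝ, weight (interpForm blk Δ (update s i t₀)) φ * source f φ)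
        - (∫ φ : α → ℝ, (∑ j ∈ univ.erase i, s j * blockPair blk Δ φ i j) *
            (weight (interpForm blk Δ (update s i t₀)) φ * source f φ))
          / (∫ φ : α → ℝ, weight (interpForm blk Δ (update s i t₀)) φ * source f φ)
          * ((∫ φ : α → ℝ, G φ * (weight (interpForm blk Δ (update s i t₀)) φ * source f φ))
            / ∫ φ : α → ℝ, weight (interpForm blk Δ (update s i t₀)) φ * source f φ))) t₀ := by
  have hN := (hasDerivAt_integral_interp blk hΔ hc hcΔ hCΔ hs i ht₀ f hGm hK).2
  have hZ' := (hasDerivAt_integral_interp blk hΔ hc hcΔ hCΔ hs i ht₀ f (G := fun _ => (1:ℝ))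
    aestronglyMeasurable_const (K₀ := 1) (fun _ => norm_one.le)).2
  have hZ : HasDerivAt (fun u => ∫ φ : α → ℝ, weight (interpForm blk Δ (update s i u)) φ * source f φ)
      (-(∫ φ : α → ℝ, (∑ j ∈ univ.erase i, s j * blockPair blk Δ φ i j) *
        (weight (interpForm blk Δ (update s i t₀)) φ * source f φ))) t₀ := by
    simp only [one_mul, mul_one] at hZ'
    exact hZ'
  have hZ0 : (∫ φ : α → ℝ, weight (interpForm blk Δ (update s i t₀)) φ * source f φ) ≠ 0 :=
    (integral_weight_mul_source_pos (interpForm_posDef blk hΔ (update_mem_cube hs i ht₀)) f).ne'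
  refine (hN.div hZ hZ0).congr_deriv ?_
  field_simp
  ring

/-! ## §5  "Subsequent derivatives either hit factors s_j already pulled down …" -/

/-- **The pulled-down factor is affine in the other parameters**: for `i′ ≠ i`,
`∂/∂s_{i′} D_i = ∂/∂s_{i′} Σ_{j≠i} s_j⟨□_iΦ,Δ□_jΦ⟩ = ⟨□_iΦ, Δ□_{i′}Φ⟩` — what a subsequent derivative produces when it
*"hit[s] factors s_j already pulled down"*. [cite: BalabanImbrieJaffe1988, §5.13 p.305] -/
theorem hasDerivAt_pulledFactor (Δ : Matrix α α ℝ) (s : I → ℝ) {i i' : I} (hii' : i' ≠ i) (φ : α → ℝ) (u : ℝ) :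
    HasDerivAt (fun v => ∑ j ∈ univ.erase i, update s i' v j * blockPair blk Δ φ i j)
      (blockPair blk Δ φ i i') u := by
  have hmem : i' ∈ univ.erase i := Finset.mem_erase.2 ⟨hii', Finset.mem_univ _⟩
  have h : ∀ v : ℝ, ∑ j ∈ univ.erase i, update s i' v j * blockPair blk Δ φ i j
      = v * blockPair blk Δ φ i i' + ∑ j ∈ (univ.erase i).erase i', s j * blockPair blk Δ φ i j := fun v => by
    rw [← Finset.add_sum_erase _ _ hmem, update_self]
    congr 1
    exact Finset.sum_congr rfl fun j hj => by rw [update_of_ne (Finset.ne_of_mem_erase hj)]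
  simp_rw [h]
  have hd := ((hasDerivAt_id' u).mul_const (blockPair blk Δ φ i i')).add_const
    (∑ j ∈ (univ.erase i).erase i', s j * blockPair blk Δ φ i j)
  rw [one_mul] at hd
  exact hd

end Literature.MathematicalPhysics.QuantumFieldTheory.BalabanImbrieJaffe1984to88.BIJ88SDerivative305
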